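import Literature.Geometry.Kaehler.HolomorphicChainDensityBound
import Literature.Geometry.Kaehler.HolomorphicChainBlowUp
import Literature.Geometry.Kaehler.HolomorphicChainRectifiableHolds
import Literature.Geometry.Kaehler.HolomorphicChainBoundary
import Literature.Geometry.GeometricMeasureTheory.CurrentsRestrict
import Literature.Geometry.GeometricMeasureTheory.CurrentsVariationMeasure
import Literature.Geometry.GeometricMeasureTheory.RectifiableAdd
import Literature.Geometry.GeometricMeasureTheory.CurrentsRepresentable

/-!
# Pieces of the blow-ups of a holomorphic chain as currents on the whole space

The blow-up `D_r = (1/r)_*(τ_{-b})_*[T]` of a holomorphic `p`-chain (`HolomorphicChain.blowUp`)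
is a current on the unit ball with data `(A_r⁻¹ reg|T| ∩ B(0,1), θ_T ∘ A_r, ξ_T ∘ A_r)`,
`A_r y = b + r y`. For the retraction argument of King's tangent cone theorem one works with its
**pieces** `D_r ⌞ G = [A_r⁻¹ reg|T| ∩ G, θ_T ∘ A_r, ξ_T ∘ A_r]` over Borel sets
`G ⊆ 𝐁(0, ρ₀)`, `ρ₀ < 1`, regarded as currents on all of `V` (`HolomorphicChain.blowUpPiece`):

* `HolomorphicChain.isRectifiableData_blowUpPiece` / `isRectifiable_blowUpPiece` — admissible
  rectifiable data on `⊤`, compact support (`IsRectifiableData.to_top`: data compactly inside `Ω`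
  are data on the whole space);
* `HolomorphicChain.blowUp_apply_eq_blowUpPiece` — `D_r(ψ) = (D_r ⌞ G)(ψ)` for `spt ψ ⊆ G`;
* `HolomorphicChain.boundary_blowUpPiece_apply_eq_zero` — `∂(D_r ⌞ G)(φ) = 0` for
  `spt φ ⊆ U ⊆ G`, `U` open (blow-ups are cycles, `boundary_blowUp_eq_zero'`);
* `HolomorphicChain.lintegral_blowUpDensity_ball_le` — **uniform density bounds**
  `∫_{A_r⁻¹ reg|T| ∩ B(y,s)} |θ_T ∘ A_r| d𝓗^{2p} ≤ C s^{2p}` for all small `r`, all centres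
  `y ∈ 𝐁(0,1)` and radii `s ≤ 1` (scaling + `exists_lintegral_density_ball_le`, under the
  monotonicity fact `Chirka1989_massRatio_monotoneOn` as a hypothesis).

Definitions with bodies + theorems; no named facts.

## References

* H. Federer, *Geometric Measure Theory*, Springer 1969, 4.1.7, 4.1.28, 4.3.16 [Federer1969].
* R. Harvey, *Holomorphic chains and their boundaries*, PSPUM XXX.1 (1977), §1.10 [Harvey1977].
-/

noncomputable section

open scoped Manifold Topology ENNReal NNReal
open Set Filter MeasureTheory Metric Function TopologicalSpace

/-! ### Data compactly inside `Ω` are data on the whole space -/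

namespace Literature.Geometry.GeometricMeasureTheory

variable {V : Type*} [NormedAddCommGroup V] [InnerProductSpace ℝ V] [FiniteDimensional ℝ V]
  [MeasurableSpace V] [BorelSpace V] {m : ℕ} {Ω : Opens V}

omit [FiniteDimensional ℝ V] in
-- Nested operator-norm instances on `Multivector V m`.
set_option maxSynthPendingDepth 2 in
/-- **Admissible data carried by a closed subset of `Ω` are admissible on the whole space**
(local summability off the closed carrier is trivial). [cite: Federer1969, 4.1.28] -/
theorem IsRectifiableData.to_top {W : Set V} {θ : V → ℤ} {ξ : V → Fin m → V}
    (h : IsRectifiableData Ω m W θ ξ) {C : Set V} (hWC : W ⊆ C) (hC : IsClosed C)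
    (hCΩ : C ⊆ (Ω : Set V)) : IsRectifiableData (⊤ : Opens V) m W θ ξ := by
  obtain ⟨hWm, -, hrect, hint, hae⟩ := h
  refine ⟨hWm, subset_univ _, hrect, ?_, hae⟩
  intro x _
  by_cases hx : x ∈ (Ω : Set V)
  · obtain ⟨u, hu, hui⟩ := hint x hx
    rw [nhdsWithin_eq_nhds.2 (Ω.isOpen.mem_nhds hx)] at hu
    exact ⟨u, mem_nhdsWithin_of_mem_nhds hu, hui⟩
  · have hxC : x ∉ C := fun h => hx (hCΩ h)
    refine ⟨Cᶜ, mem_nhdsWithin_of_mem_nhds (hC.isOpen_compl.mem_nhds hxC), ?_⟩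
    have h0 : (μHE[m] : Measure V).restrict W Cᶜ = 0 := by
      rw [Measure.restrict_apply hC.measurableSet.compl]
      exact measure_mono_null (fun y hy => (hy.1 (hWC hy.2)).elim) (measure_empty (μ := μHE[m]))
    rw [IntegrableOn, Measure.restrict_eq_zero.2 h0]
    exact integrable_zero_measure

end Literature.Geometry.GeometricMeasureTheory

namespace Literature.Geometry.Kaehler

open Literature.Geometry.GeometricMeasureTheory

namespace HolomorphicChain

universe u

variable {V : Type u} [NormedAddCommGroup V] [InnerProductSpace ℂ V] [FiniteDimensional ℂ V]
  [MeasurableSpace V] [BorelSpace V] {Ω : Opens V} {p : ℕ}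

/-- The pulled-back carrier `A_r⁻¹(reg|T|)`, `A_r y = b + r y`. [cite: Federer1969, 4.3.16] -/
def blowUpSet (T : HolomorphicChain 𝓘(ℂ, V) Ω p) (b : V) (r : ℝ) : Set V :=
  (fun y : V => b + r • y) ⁻¹' T.carrier

/-- The pulled-back density `θ_T ∘ A_r`. [cite: Federer1969, 4.3.16] -/
def blowUpDensity (T : HolomorphicChain 𝓘(ℂ, V) Ω p) (b : V) (r : ℝ) : V → ℤ :=
  fun y => T.density (b + r • y)

/-- The pulled-back orientation `ξ_T ∘ A_r`. [cite: Federer1969, 4.3.16] -/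
def blowUpFrame (T : HolomorphicChain 𝓘(ℂ, V) Ω p) (b : V) (r : ℝ) : V → Fin (2 * p) → V :=
  fun y => T.orientationFrame (b + r • y)

/-- **The piece `D_r ⌞ G` of the blow-up over `G`, as a current on the whole space.**
[cite: Federer1969, 4.1.7, 4.3.16] -/
def blowUpPiece (T : HolomorphicChain 𝓘(ℂ, V) Ω p) (b : V) (r : ℝ) (G : Set V) :
    Current (⊤ : Opens V) (2 * p) :=
  currentOfIntegration (T.blowUpSet b r ∩ G) (T.blowUpDensity b r) (T.blowUpFrame b r)

/-- `blowUpSet` is measurable. [folklore] -/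
theorem measurableSet_blowUpSet (T : HolomorphicChain 𝓘(ℂ, V) Ω p) (b : V) (r : ℝ) :
    MeasurableSet (T.blowUpSet b r) :=
  T.measurableSet_carrier.preimage ((measurable_const_smul r).const_add b)

omit [FiniteDimensional ℂ V] in
/-- The blow-up is the current of the same data restricted to the unit ball. [folklore] -/
theorem blowUp_eq (T : HolomorphicChain 𝓘(ℂ, V) Ω p) (b : V) (r : ℝ) :
    T.blowUp b r = currentOfIntegration (T.blowUpSet b r ∩ ball (0 : V) 1) (T.blowUpDensity b r)
      (T.blowUpFrame b r) := rfl

/-- **The pieces have admissible data on the whole space** (`G ⊆ 𝐁(0,ρ₀)` Borel, `ρ₀ < 1`,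
`B(b, r) ⊆ Ω`). [cite: Federer1969, 4.1.28, 4.3.16] -/
theorem isRectifiableData_blowUpPiece (T : HolomorphicChain 𝓘(ℂ, V) Ω p) {b : V} {r : ℝ}
    (hr : 0 < r) (hball : ball b r ⊆ (Ω : Set V)) {G : Set V} (hGm : MeasurableSet G) {ρ₀ : ℝ}
    (hρ₀ : ρ₀ < 1) (hG : G ⊆ closedBall (0 : V) ρ₀) :
    letI : InnerProductSpace ℝ V := InnerProductSpace.complexToReal
    IsRectifiableData (⊤ : Opens V) (2 * p) (T.blowUpSet b r ∩ G) (T.blowUpDensity b r)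
      (T.blowUpFrame b r) := by
  letI : InnerProductSpace ℝ V := InnerProductSpace.complexToReal
  have hT := Harvey1977_isRectifiableData_toCurrent_holds V Ω p T
  have h0 : IsRectifiableData (unitBall V) (2 * p) (T.blowUpSet b r ∩ ball (0 : V) 1)
      (T.blowUpDensity b r) (T.blowUpFrame b r) := T.isRectifiableData_blowUp hT hr hball
  have h1 := h0.inter hGm
  have hG1 : G ⊆ ball (0 : V) 1 := hG.trans (closedBall_subset_ball hρ₀)
  have hset : T.blowUpSet b r ∩ ball (0 : V) 1 ∩ G = T.blowUpSet b r ∩ G := by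
    rw [inter_assoc, inter_eq_right.2 hG1]
  rw [hset] at h1
  exact h1.to_top (inter_subset_right.trans hG) isClosed_closedBall (closedBall_subset_ball hρ₀)

/-- **The pieces are rectifiable currents** (compact support in `𝐁(0, ρ₀)`).
[cite: Federer1969, 4.1.24, 4.1.28] -/
theorem isRectifiable_blowUpPiece (T : HolomorphicChain 𝓘(ℂ, V) Ω p) {b : V} {r : ℝ}
    (hr : 0 < r) (hball : ball b r ⊆ (Ω : Set V)) {G : Set V} (hGm : MeasurableSet G) {ρ₀ : ℝ}
    (hρ₀ : ρ₀ < 1) (hG : G ⊆ closedBall (0 : V) ρ₀) :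
    letI : InnerProductSpace ℝ V := InnerProductSpace.complexToReal
    (T.blowUpPiece b r G).IsRectifiable := by
  letI : InnerProductSpace ℝ V := InnerProductSpace.complexToReal
  haveI : FiniteDimensional ℝ V := FiniteDimensional.complexToReal V
  haveI : ProperSpace V := FiniteDimensional.proper ℝ V
  refine ⟨⟨_, _, _, T.isRectifiableData_blowUpPiece hr hball hGm hρ₀ hG, rfl⟩, ?_⟩
  refine Current.isCompact_support_of_subset _ (isCompact_closedBall (0 : V) ρ₀) (subset_univ _) ?_
  exact (support_currentOfIntegration_subset_closure _ _ _).trans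
    (closure_minimal (inter_subset_right.trans hG) isClosed_closedBall)

omit [FiniteDimensional ℂ V] in
/-- The support of a piece lies in `closure G`. [folklore] -/
theorem support_blowUpPiece_subset (T : HolomorphicChain 𝓘(ℂ, V) Ω p) (b : V) (r : ℝ) (G : Set V) :
    (T.blowUpPiece b r G).support ⊆ closure G :=
  (support_currentOfIntegration_subset_closure _ _ _).trans (closure_mono inter_subset_right)

/-- **`D_r(ψ) = (D_r ⌞ G)(ψ)` for test forms supported in `G`.** [cite: Federer1969, 4.1.7] -/
theorem blowUp_apply_eq_blowUpPiece (T : HolomorphicChain 𝓘(ℂ, V) Ω p) {b : V} {r : ℝ}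
    (hr : 0 < r) (hball : ball b r ⊆ (Ω : Set V)) {G : Set V} (hGm : MeasurableSet G) {ρ₀ : ℝ}
    (hρ₀ : ρ₀ < 1) (hG : G ⊆ closedBall (0 : V) ρ₀) (ψ : TestForm (unitBall V) (2 * p))
    (hψ : tsupport ⇑ψ ⊆ G) :
    T.blowUp b r ψ = T.blowUpPiece b r G (TestFunction.monoCLM ℝ ψ) := by
  letI : InnerProductSpace ℝ V := InnerProductSpace.complexToReal
  have hT := Harvey1977_isRectifiableData_toCurrent_holds V Ω p T
  have h1 : IsRectifiableData (unitBall V) (2 * p) (T.blowUpSet b r ∩ ball (0 : V) 1)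
      (T.blowUpDensity b r) (T.blowUpFrame b r) := T.isRectifiableData_blowUp hT hr hball
  have h2 := T.isRectifiableData_blowUpPiece hr hball hGm hρ₀ hG
  have hG1 : G ⊆ ball (0 : V) 1 := hG.trans (closedBall_subset_ball hρ₀)
  rw [blowUp_eq, blowUpPiece, currentOfIntegration_apply h1.2.2.2.1, currentOfIntegration_apply h2.2.2.2.1,
    TestForm.monoCLM_apply_of_le (show unitBall V ≤ (⊤ : Opens V) from le_top)]
  refine setIntegral_eq_of_subset_of_forall_sdiff_eq_zero
    ((T.measurableSet_blowUpSet b r).inter measurableSet_ball) (inter_subset_inter_right _ hG1) ?_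
  intro x hx
  have hxW : x ∈ T.blowUpSet b r := hx.1.1
  have hxG' : x ∉ G := fun h => hx.2 ⟨hxW, h⟩
  have hx' : x ∉ tsupport ⇑ψ := fun h => hxG' (hψ h)
  simp [image_eq_zero_of_notMem_tsupport hx']

omit [InnerProductSpace ℂ V] [FiniteDimensional ℂ V] [MeasurableSpace V] [BorelSpace V] in
/-- `spt (dφ) ⊆ spt φ` for test forms (a private copy of `TestForm.tsupport_extDerivCLM_subset`
from `FlatComplete.lean`, to keep the imports light). [folklore] -/
private theorem tsupport_extDerivCLM_subset_aux [NormedSpace ℝ V] {Ω' : Opens V} {m : ℕ}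
    (φ : TestForm Ω' m) : tsupport ⇑(TestForm.extDerivCLM φ) ⊆ tsupport ⇑φ := by
  rw [TestForm.extDerivCLM_apply]
  refine closure_minimal (fun x hx => ?_) (isClosed_tsupport _)
  refine support_fderiv_subset ℝ (fun h => hx ?_)
  change ContinuousAlternatingMap.alternatizeUncurryFin (fderiv ℝ (⇑φ) x) = 0
  rw [h]
  exact map_zero (ContinuousAlternatingMap.alternatizeUncurryFinCLM ℝ V ℝ)

/-- **Pieces of blow-ups have no boundary inside `G`**: `∂(D_r ⌞ G)(φ) = 0` whenever
`spt φ ⊆ U ⊆ G` (`p ≥ 1`; the blow-ups are cycles on the unit ball).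
[cite: Federer1969, 4.1.7, 4.1.14; Harvey1977, §1.10] -/
theorem boundary_blowUpPiece_apply_eq_zero {q : ℕ} (T : HolomorphicChain 𝓘(ℂ, V) Ω (q + 1)) {b : V}
    {r : ℝ} (hr : 0 < r) (hball : ball b r ⊆ (Ω : Set V)) {G : Set V} (hGm : MeasurableSet G)
    {ρ₀ : ℝ} (hρ₀ : ρ₀ < 1) (hG : G ⊆ closedBall (0 : V) ρ₀) {U : Set V}
    (hUG : U ⊆ G) (φ : TestForm (⊤ : Opens V) (2 * q + 1)) (hφ : tsupport ⇑φ ⊆ U) :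
    (T.blowUpPiece b r G).boundary φ = 0 := by
  have hG1 : G ⊆ ball (0 : V) 1 := hG.trans (closedBall_subset_ball hρ₀)
  -- `φ` as a test form on the unit ball
  set φ' : TestForm (unitBall V) (2 * q + 1) :=
    ⟨φ, φ.contDiff, φ.hasCompactSupport, (hφ.trans hUG).trans hG1⟩ with hφ'
  have hle : unitBall V ≤ (⊤ : Opens V) := le_top
  have hmono : (TestFunction.monoCLM ℝ φ' : TestForm (⊤ : Opens V) (2 * q + 1)) = φ := by
    ext x v
    rw [TestForm.monoCLM_apply_of_le hle]
    rfl
  have hd : tsupport ⇑(TestForm.extDerivCLM φ') ⊆ G :=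
    (tsupport_extDerivCLM_subset_aux φ').trans (hφ.trans hUG)
  rw [Current.boundary_apply, ← hmono, TestForm.extDerivCLM_monoCLM hle,
    ← T.blowUp_apply_eq_blowUpPiece hr hball hGm hρ₀ hG _ hd, ← Current.boundary_apply,
    T.boundary_blowUp_eq_zero' Harvey1977_isRectifiableData_toCurrent_holds
      Harvey1977_boundary_toCurrent_eq_zero_holds hr hball]
  rfl

omit [FiniteDimensional ℂ V] [MeasurableSpace V] [BorelSpace V] in
/-- `A_r⁻¹(reg|T|) ∩ B(y, s) = A_r⁻¹(reg|T| ∩ B(b + r y, r s))`. [folklore] -/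
theorem blowUpSet_inter_ball (T : HolomorphicChain 𝓘(ℂ, V) Ω p) (b : V) {r : ℝ} (hr : 0 < r)
    (y : V) (s : ℝ) :
    T.blowUpSet b r ∩ ball y s = (fun x : V => b + r • x) ⁻¹' (T.carrier ∩ ball (b + r • y) (r * s)) := by
  ext x
  simp only [blowUpSet, mem_inter_iff, mem_preimage, mem_ball, dist_eq_norm]
  rw [show b + r • x - (b + r • y) = r • (x - y) by rw [smul_sub]; abel, norm_smul,
    Real.norm_of_nonneg hr.le]
  constructor
  · rintro ⟨h1, h2⟩; exact ⟨h1, by nlinarith⟩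
  · rintro ⟨h1, h2⟩; exact ⟨h1, by nlinarith⟩

omit [FiniteDimensional ℂ V] in
/-- **Scaling of the pulled-back density integral**:
`∫_{A_r⁻¹ reg|T| ∩ B(y,s)} |θ_T ∘ A_r| d𝓗^{2p} = r^{-2p} ∫_{reg|T| ∩ B(b + r y, r s)} |θ_T| d𝓗^{2p}`.
[cite: Federer1969, 4.3.16; Harvey1977, §1.10] -/
theorem lintegral_blowUpDensity_inter_ball (T : HolomorphicChain 𝓘(ℂ, V) Ω p) (b : V) {r : ℝ}
    (hr : 0 < r) (y : V) (s : ℝ) :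
    ∫⁻ x in T.blowUpSet b r ∩ ball y s, ‖(T.blowUpDensity b r x : ℝ)‖ₑ ∂(μHE[2 * p] : Measure V) =
      ENNReal.ofReal (r⁻¹ ^ (2 * p)) *
        ∫⁻ x in T.carrier ∩ ball (b + r • y) (r * s), ‖(T.density x : ℝ)‖ₑ ∂(μHE[2 * p] : Measure V) := by
  letI : InnerProductSpace ℝ V := InnerProductSpace.complexToReal
  rw [T.blowUpSet_inter_ball b hr y s]
  let eA : V ≃ᵐ V :=
    ((Homeomorph.smulOfNeZero r hr.ne').trans (Homeomorph.addLeft b)).toMeasurableEquiv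
  have heA : ⇑eA = fun x : V => b + r • x := rfl
  have h1 : ∫⁻ x in (fun x : V => b + r • x) ⁻¹' (T.carrier ∩ ball (b + r • y) (r * s)),
      ‖((T.blowUpDensity b r x : ℤ) : ℝ)‖ₑ ∂(μHE[2 * p] : Measure V) =
      ∫⁻ x, ‖((T.density x : ℤ) : ℝ)‖ₑ ∂(Measure.map eA ((μHE[2 * p] : Measure V).restrict
        ((fun x : V => b + r • x) ⁻¹' (T.carrier ∩ ball (b + r • y) (r * s))))) := by
    rw [lintegral_map_equiv]
    rfl
  rw [h1, heA, map_add_smul_restrict_preimage b hr, lintegral_smul_measure, smul_eq_mul]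

/-- **Uniform density bounds for the blow-ups**: with `B(b, 3R₁) ⊆ Ω`, `0 < R₁`, there is
`C < ∞` such that `∫_{A_r⁻¹ reg|T| ∩ B(y,s)} |θ_T ∘ A_r| d𝓗^{2p} ≤ C s^{2p}` for all
`0 < r ≤ R₁/2`, `‖y‖ ≤ 1`, `0 < s ≤ 1` (scaling + `exists_lintegral_density_ball_le`).
[cite: Chirka1989, §15.1 Prop. 1, §16.1; Harvey1977, §1.10] -/
theorem exists_lintegral_blowUpDensity_ball_le (hmono : Chirka1989_massRatio_monotoneOn.{u})
    (T : HolomorphicChain 𝓘(ℂ, V) Ω p) {b : V} {R₁ : ℝ} (hR₁ : 0 < R₁)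
    (hball : ball b (3 * R₁) ⊆ (Ω : Set V)) :
    ∃ C : ℝ≥0∞, C ≠ ⊤ ∧ ∀ r : ℝ, 0 < r → r ≤ R₁ / 2 → ∀ y ∈ closedBall (0 : V) 1, ∀ s : ℝ,
      0 < s → s ≤ 1 →
      ∫⁻ x in T.blowUpSet b r ∩ ball y s, ‖(T.blowUpDensity b r x : ℝ)‖ₑ ∂(μHE[2 * p] : Measure V) ≤
        C * ENNReal.ofReal (s ^ (2 * p)) := by
  obtain ⟨C, hC, hle⟩ := T.exists_lintegral_density_ball_le hmono hR₁ hball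
  refine ⟨C, hC, fun r hr hrR y hy s hs hs1 => ?_⟩
  rw [T.lintegral_blowUpDensity_inter_ball b hr y s]
  rw [mem_closedBall, dist_zero_right] at hy
  have ha : b + r • y ∈ closedBall b R₁ := by
    rw [mem_closedBall, dist_eq_norm, add_sub_cancel_left, norm_smul, Real.norm_of_nonneg hr.le]
    nlinarith
  have ht : r * s ≤ R₁ := by nlinarith
  calc ENNReal.ofReal (r⁻¹ ^ (2 * p)) *
        ∫⁻ x in T.carrier ∩ ball (b + r • y) (r * s), ‖(T.density x : ℝ)‖ₑ ∂(μHE[2 * p] : Measure V)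
      ≤ ENNReal.ofReal (r⁻¹ ^ (2 * p)) * (C * ENNReal.ofReal ((r * s) ^ (2 * p))) := by
        gcongr
        exact hle _ ha _ (mul_pos hr hs) ht
    _ = C * ENNReal.ofReal (s ^ (2 * p)) := by
        rw [mul_left_comm, ← ENNReal.ofReal_mul (pow_nonneg (inv_nonneg.2 hr.le) _), ← mul_pow,
          ← mul_assoc, inv_mul_cancel₀ hr.ne', one_mul]

end HolomorphicChain

end Literature.Geometry.Kaehler
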